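import Summits.AtomisticToContinuum.FouriersLaw.Theorems.JunctionLocalityNonBallisticStubBulkWindowDynamicalMatchingAux1
import Summits.AtomisticToContinuum.FouriersLaw.Theorems.EmbeddedDrudeMourreAbelThermodynamicLimitDynamicalMatchingBadEvent

/-!
# Stub `stub_bulkWindowDynamicalMatching` (F1a) of line `drude-controls-conductance` (R2b) — crux
`JunctionLocality.NonBallistic` (stmt-AtomisticToContinuum-9127), part 3: the good event of the ANCHORED box and its
improbable complement

Helper file (`--supports stmt-AtomisticToContinuum-9127`); nothing here closes the item.

Anchored port of `EmbeddedDrudeMourreAbelThermodynamicLimitDynamicalMatchingBadEvent.lean` §§2–3 (line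
`loomis-compact-horizon-witness`; its anchor-free §1 — `severed_box_bounds`, `initial_box_position_le` — is reused):

* §6 THE GOOD EVENT: local energy `W_{0,R+1}(ι_{N,a} z) ≤ lam R²/4` and time-integrated squared momenta
  `∫₀ᵗ p_m(Φ_r)² dr ≤ R` on the window `|m - a| ≤ R + 1` force all positions of BOTH flows at `|j| ≤ R+1` into
  `[-ρ, ρ]` on `[0,t]`, `ρ = (2+2t)√R` (kinematic bound `q(s)² ≤ 2q(0)² + 2t∫p²` at every chain site,
  `pinnedChain_solMap_position_sq_le`), and the severed box momenta `≤ √(lam/2) R`;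
* §7 the complement has probability `≤ (2R+3)C/(lam R²/4) + (2R+3)·2027025 T⁸t⁸/R⁸` under `μ_{N,T} ⊗ W`, uniformly in
  `N` AND in the anchor (Markov with the energy mean `(2R+3)C` of part 2; the SITE-uniform eighth-power tail
  `pinnedChain_probSite_timeIntegral_momentum_sq_gt_eight`; union bound over the `2R+3` window sites `a-R-1, …, a+R+1`).

All statements proved; `[folklore]`. No definitions.
-/

noncomputable section

namespace Summit.AtomisticToContinuum.FouriersLaw.Theorems.NonBallistic.BulkWindowMatching

open MeasureTheory ProbabilityTheory Set Filter Topology Function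
open scoped NNReal ENNReal
open Literature.MathematicalPhysics.KineticTheory Literature.MathematicalPhysics.KineticTheory.HeatConduction
open Literature.Probability.Process OscillatorChain
open Summit.AtomisticToContinuum.FouriersLaw.Theorems.AbelThermodynamicLimit.LoomisCompactHorizonWitness

variable {N : ℕ} {ω₂ lam β γ : ℝ}

/-! ### §6 On the good event both flows keep the box positions in `[-ρ, ρ]`, `ρ = (2 + 2t)√R` -/

section GoodEvent

/-- **The good event of the anchored box.** For the pinned chain (all parameters admissible, `lam > 0`), `R + 1 ≤ a`,
`a + R + 3 ≤ N`, `R ≥ 1`, `t ≥ 0` and a sample `(z, ω)` with (i) local energy `W_{0,R+1}(ι_{N,a} z) ≤ lam R²/4` and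
(ii) time-integrated squared momenta `∫₀ᵗ p_m(Φ_r)² dr ≤ R` at every chain site `m` of the window `|m - a| ≤ R + 1`:
along BOTH the open chain `Φ_s(z, Bω)` (read through `ι_{N,a}`) and the severed flow `T^{Λ_R}_s(ι_{N,a} z)` every position
at the sites `|j| ≤ R + 1` stays in `[-ρ, ρ]` on `[0, t]`, `ρ = (2 + 2t)√R`, and the severed box momenta at time `t` are
`≤ √(lam/2) R` (adapted from `good_event_bounds`). [folklore] -/
theorem bulk_good_event_bounds (hω : 0 < ω₂) (hl : 0 < lam) (hβ : 0 ≤ β) (hγ : 0 ≤ γ)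
    (hB1 : (pinnedChain ω₂ lam β γ).CondB1) (ι : (N : ℕ) → ℕ → PhaseSpace N → ChainConfig)
    (hι : ∀ (N a : ℕ) (z : PhaseSpace N) (i : ℤ), ι N a z i =
      if h : 0 ≤ i + (a : ℤ) ∧ i + (a : ℤ) < N then
        (z.1 ⟨(i + (a : ℤ)).toNat, by omega⟩, z.2 ⟨(i + (a : ℤ)).toNat, by omega⟩)
      else (0, 0)) {a : ℕ}
    {R : ℕ} (hRa : R + 1 ≤ a) (haN : a + R + 3 ≤ N) (hR1 : 1 ≤ R) (T : ℝ) {t : ℝ} (ht : 0 ≤ t)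
    (q : PhaseSpace N × WienerPair)
    (hW : (pinnedChain ω₂ lam β γ).bmLocalEnergy 0 (R + 1) (ι N a q.1) ≤ lam * (R : ℝ) ^ 2 / 4)
    (hX : ∀ m : Fin N, -((R : ℤ) + 1) ≤ (m : ℤ) - (a : ℤ) → (m : ℤ) - (a : ℤ) ≤ (R : ℤ) + 1 →
      ∫ r in (0:ℝ)..t, ((pinnedChain ω₂ lam β γ).solMap N T T r q.1 (pairPath q.2)).2 m ^ 2 ≤ R) :
    (∀ s ∈ Icc (0:ℝ) t, ∀ j : ℤ, -((R : ℤ) + 1) ≤ j → j ≤ (R : ℤ) + 1 →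
      |(ι N a ((pinnedChain ω₂ lam β γ).chainFlow N q.1 (chainNoise N (Real.sqrt (2 * (pinnedChain ω₂ lam β γ).γ * T))
        (Real.sqrt (2 * (pinnedChain ω₂ lam β γ).γ * T)) (pairPath q.2)) s) j).1| ≤ (2 + 2 * t) * Real.sqrt R ∧
      |(severedFlow hB1 (Finset.Icc (-(R : ℤ)) R) s (ι N a q.1) j).1| ≤ (2 + 2 * t) * Real.sqrt R) ∧
    ∀ i ∈ Finset.Icc (-(R : ℤ)) R, |(severedFlow hB1 (Finset.Icc (-(R : ℤ)) R) t (ι N a q.1) i).2| ≤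
      Real.sqrt (lam / 2) * R := by
  -- adapted from `LoomisCompactHorizonWitness.good_event_bounds` (anchor `(N-1)/2`, `2R+4 ≤ N`)
  set P := pinnedChain ω₂ lam β γ with hP
  have hR0 : (0 : ℝ) ≤ R := by positivity
  have hsq : Real.sqrt (R : ℝ) ^ 2 = R := Real.sq_sqrt hR0
  have hsq4 : Real.sqrt (R : ℝ) ^ 4 = (R : ℝ) ^ 2 := by rw [show (4:ℕ) = 2 * 2 by rfl, pow_mul, hsq]
  have hW' : P.bmLocalEnergy 0 (R + 1) (ι N a q.1) ≤ lam * Real.sqrt (R : ℝ) ^ 4 / 4 := by rw [hsq4]; exact hW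
  have hρ1 : Real.sqrt (R : ℝ) ≤ (2 + 2 * t) * Real.sqrt R := le_mul_of_one_le_left (Real.sqrt_nonneg _) (by linarith)
  -- initial positions of the window from the local energy
  have hinit : ∀ j : ℤ, -((R : ℤ) + 1) ≤ j → j ≤ (R : ℤ) + 1 → |(ι N a q.1 j).1| ≤ Real.sqrt R := fun j hj1 hj2 =>
    initial_box_position_le hω.le hl β γ hβ R (ι N a q.1) (Real.sqrt_nonneg _) hW' j
      (by simp only [Finset.mem_Icc]; omega)
  refine ⟨fun s hs j hj1 hj2 => ⟨?_, ?_⟩, fun i hi => ?_⟩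
  · -- open chain: kinematic bound at the chain site `m = j + a`
    have hj0 : 0 ≤ j + (a : ℤ) := by omega
    set m : Fin N := ⟨(j + (a : ℤ)).toNat, by omega⟩ with hmdef
    have hmj : (m : ℤ) = j + (a : ℤ) := by
      show (((j + (a : ℤ)).toNat : ℕ) : ℤ) = j + (a : ℤ); exact Int.toNat_of_nonneg hj0
    have happ : ∀ y : PhaseSpace N, ι N a y j = (y.1 m, y.2 m) := fun y => bulk_embedding_apply_of_eq ι hι y j m hmj
    have hkin := pinnedChain_solMap_position_sq_le ω₂ lam β γ hω hl.le hβ hγ N T T q.1 (pairPath q.2) t s hs m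
    have hq0 : q.1.1 m ^ 2 ≤ R := by
      have h := hinit j hj1 hj2
      rw [happ] at h
      have h2 : |q.1.1 m| ^ 2 ≤ Real.sqrt (R : ℝ) ^ 2 := pow_le_pow_left₀ (abs_nonneg _) h 2
      rwa [sq_abs, hsq] at h2
    have hXm := hX m (by rw [hmj]; omega) (by rw [hmj]; omega)
    have hpos : (P.solMap N T T s q.1 (pairPath q.2)).1 m ^ 2 ≤ (2 + 2 * t) * R := by
      calc _ ≤ 2 * q.1.1 m ^ 2 + 2 * t * ∫ r in (0:ℝ)..t, (P.solMap N T T r q.1 (pairPath q.2)).2 m ^ 2 := hkin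
        _ ≤ 2 * R + 2 * t * R := by nlinarith [hs.1.trans hs.2]
        _ = (2 + 2 * t) * R := by ring
    show |(ι N a (P.solMap N T T s q.1 (pairPath q.2)) j).1| ≤ (2 + 2 * t) * Real.sqrt R
    rw [happ]
    calc |(P.solMap N T T s q.1 (pairPath q.2)).1 m| = Real.sqrt ((P.solMap N T T s q.1 (pairPath q.2)).1 m ^ 2) :=
          (Real.sqrt_sq_eq_abs _).symm
      _ ≤ Real.sqrt ((2 + 2 * t) * R) := Real.sqrt_le_sqrt hpos
      _ ≤ (2 + 2 * t) * Real.sqrt R := sqrt_mul_le_mul_sqrt (by linarith) _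
  · -- severed flow: box sites by energy conservation, outer neighbours frozen
    by_cases hjΛ : j ∈ Finset.Icc (-(R : ℤ)) R
    · exact ((severed_box_bounds hω.le hl hβ γ hB1 R (ι N a q.1) (Real.sqrt_nonneg _) hW' s j hjΛ).1).trans hρ1
    · rw [severedFlow_apply_of_not_mem hB1 _ s _ hjΛ]
      exact (hinit j hj1 hj2).trans hρ1
  · have h := (severed_box_bounds hω.le hl hβ γ hB1 R (ι N a q.1) (Real.sqrt_nonneg _) hW' t i hi).2
    rwa [hsq] at h

end GoodEvent

/-! ### §7 The bad event is improbable, uniformly in `N` and in the anchor -/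

section BadEvent

variable (hω : 0 < ω₂) (hl : 0 < lam) (hβ : 0 < β) (hγ : 0 < γ) {T : ℝ} (hT : 0 < T)
include hω hl hβ hγ hT

/-- **The bad event of the anchored box is improbable, uniformly in `N` and in the anchor.** With the `N`-uniform mean
`(2R+3)C` of the local energy (`bulk_exists_lintegral_bmLocalEnergy_le`): under `μ_{N,T} ⊗ W`, the probability that the
local energy `W_{0,R+1}(ι_{N,a} z)` exceeds `lam R²/4` OR some time-integrated squared momentum of the window
`|m - a| ≤ R + 1` exceeds `R` is at most `(2R+3)C/(lam R²/4) + (2R+3) · 2027025 T⁸ t⁸/R⁸` (Markov; the one-site tail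
with the eighth power, `pinnedChain_probSite_timeIntegral_momentum_sq_gt_eight`; union bound; adapted from
`bad_event_le`). [folklore] -/
theorem bulk_bad_event_le (ι : (N : ℕ) → ℕ → PhaseSpace N → ChainConfig)
    (hι : ∀ (N a : ℕ) (z : PhaseSpace N) (i : ℤ), ι N a z i =
      if h : 0 ≤ i + (a : ℤ) ∧ i + (a : ℤ) < N then
        (z.1 ⟨(i + (a : ℤ)).toNat, by omega⟩, z.2 ⟨(i + (a : ℤ)).toNat, by omega⟩)
      else (0, 0))
    {C : ℝ≥0∞} (hC : ∀ (N a R : ℕ), R + 1 ≤ a → a + R + 3 ≤ N →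
      ∫⁻ z, ENNReal.ofReal ((pinnedChain ω₂ lam β γ).bmLocalEnergy 0 (R + 1) (ι N a z))
          ∂((pinnedChain ω₂ lam β γ).gibbsMeasure N T) ≤ (2 * R + 3 : ℝ≥0∞) * C)
    {N a R : ℕ} (hRa : R + 1 ≤ a) (haN : a + R + 3 ≤ N) (hR1 : 1 ≤ R) {t : ℝ} (ht : 0 ≤ t) :
    (((pinnedChain ω₂ lam β γ).gibbsMeasure N T).prod wienerPair)
        ({q | lam * (R : ℝ) ^ 2 / 4 < (pinnedChain ω₂ lam β γ).bmLocalEnergy 0 (R + 1) (ι N a q.1)} ∪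
          ⋃ m ∈ (Finset.univ.filter fun m : Fin N =>
              -((R : ℤ) + 1) ≤ (m : ℤ) - (a : ℤ) ∧ (m : ℤ) - (a : ℤ) ≤ (R : ℤ) + 1),
            {q | (R : ℝ) < ∫ r in (0:ℝ)..t, ((pinnedChain ω₂ lam β γ).solMap N T T r q.1 (pairPath q.2)).2 m ^ 2}) ≤
      (2 * R + 3 : ℝ≥0∞) * C / ENNReal.ofReal (lam * (R : ℝ) ^ 2 / 4) +
        (2 * R + 3 : ℝ≥0∞) * ENNReal.ofReal (2027025 * T ^ 8 * t ^ 8 / (R : ℝ) ^ 8) := by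
  -- adapted from `LoomisCompactHorizonWitness.bad_event_le` (anchor `(N-1)/2`, `2R+4 ≤ N`)
  set P := pinnedChain ω₂ lam β γ with hP
  set μ := P.gibbsMeasure N T with hμ
  haveI : IsProbabilityMeasure μ := pinnedChain_isProbabilityMeasure_gibbsMeasure hω hl.le hβ.le γ N hT
  have hN : 0 < N := by omega
  set S : Finset (Fin N) := Finset.univ.filter fun m : Fin N =>
    -((R : ℤ) + 1) ≤ (m : ℤ) - (a : ℤ) ∧ (m : ℤ) - (a : ℤ) ≤ (R : ℤ) + 1 with hS
  -- the energy part: Markov on the first factor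
  have hιm : Measurable (ι N a) := (bulk_continuous_embedding ι hι N a).measurable
  have hWm : Measurable fun z : PhaseSpace N => ENNReal.ofReal (P.bmLocalEnergy 0 (R + 1) (ι N a z)) :=
    ((P.measurable_bmLocalEnergy (measurable_pinnedChain_U ω₂ lam β γ) (show Continuous P.V from by
      show Continuous fun r : ℝ => r ^ 2 / 2 + β * r ^ 4 / 4; fun_prop).measurable 0 (R + 1)).comp hιm).ennreal_ofReal
  have hE0 : 0 < lam * (R : ℝ) ^ 2 / 4 := by positivity
  have hA : {q : PhaseSpace N × WienerPair | lam * (R : ℝ) ^ 2 / 4 < P.bmLocalEnergy 0 (R + 1) (ι N a q.1)} ⊆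
      Prod.fst ⁻¹' {z | ENNReal.ofReal (lam * (R : ℝ) ^ 2 / 4) ≤ ENNReal.ofReal (P.bmLocalEnergy 0 (R + 1) (ι N a z))} :=
    fun q hq => ENNReal.ofReal_le_ofReal (le_of_lt hq)
  have h1 : (μ.prod wienerPair) {q : PhaseSpace N × WienerPair | lam * (R : ℝ) ^ 2 / 4 <
      P.bmLocalEnergy 0 (R + 1) (ι N a q.1)} ≤ (2 * R + 3 : ℝ≥0∞) * C / ENNReal.ofReal (lam * (R : ℝ) ^ 2 / 4) := by
    calc (μ.prod wienerPair) {q : PhaseSpace N × WienerPair | lam * (R : ℝ) ^ 2 / 4 < P.bmLocalEnergy 0 (R + 1) (ι N a q.1)}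
        ≤ (μ.prod wienerPair) (Prod.fst ⁻¹' {z | ENNReal.ofReal (lam * (R : ℝ) ^ 2 / 4) ≤
            ENNReal.ofReal (P.bmLocalEnergy 0 (R + 1) (ι N a z))}) := measure_mono hA
      _ = μ {z | ENNReal.ofReal (lam * (R : ℝ) ^ 2 / 4) ≤ ENNReal.ofReal (P.bmLocalEnergy 0 (R + 1) (ι N a z))} := by
          rw [← Set.prod_univ, Measure.prod_prod, measure_univ, mul_one]
      _ ≤ (∫⁻ z, ENNReal.ofReal (P.bmLocalEnergy 0 (R + 1) (ι N a z)) ∂μ) / ENNReal.ofReal (lam * (R : ℝ) ^ 2 / 4) :=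
          meas_ge_le_lintegral_div hWm.aemeasurable (ENNReal.ofReal_pos.2 hE0).ne' ENNReal.ofReal_ne_top
      _ ≤ (2 * R + 3 : ℝ≥0∞) * C / ENNReal.ofReal (lam * (R : ℝ) ^ 2 / 4) :=
          ENNReal.div_le_div_right (hC N a R hRa haN) _
  -- the momentum part: union bound over the window sites
  have hcard : S.card ≤ 2 * R + 3 := by
    -- `S` injects into `{-(R+1), …, R+1}` by `m ↦ m - a`
    have hinj : S.card ≤ (Finset.Icc (-((R : ℤ) + 1)) ((R : ℤ) + 1)).card := by
      refine Finset.card_le_card_of_injOn (fun m : Fin N => (m : ℤ) - (a : ℤ)) (fun m hm => ?_) ?_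
      · have hm' := (Finset.mem_filter.1 hm).2
        simp only [Finset.coe_Icc, Set.mem_Icc]; exact hm'
      · intro b _ b' _ hbb
        have : (b : ℤ) = (b' : ℤ) := by simpa using hbb
        exact Fin.ext (by exact_mod_cast this)
    rw [Int.card_Icc] at hinj
    have e : ((R : ℤ) + 1 + 1 - -((R : ℤ) + 1)).toNat = 2 * R + 3 := by omega
    rwa [e] at hinj
  have h2 : (μ.prod wienerPair) (⋃ m ∈ S, {q : PhaseSpace N × WienerPair |
      (R : ℝ) < ∫ r in (0:ℝ)..t, (P.solMap N T T r q.1 (pairPath q.2)).2 m ^ 2}) ≤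
      (2 * R + 3 : ℝ≥0∞) * ENNReal.ofReal (2027025 * T ^ 8 * t ^ 8 / (R : ℝ) ^ 8) := by
    have hR0 : (0 : ℝ) < R := by exact_mod_cast hR1
    calc (μ.prod wienerPair) (⋃ m ∈ S, {q : PhaseSpace N × WienerPair |
          (R : ℝ) < ∫ r in (0:ℝ)..t, (P.solMap N T T r q.1 (pairPath q.2)).2 m ^ 2})
        ≤ ∑ m ∈ S, (μ.prod wienerPair) {q : PhaseSpace N × WienerPair |
            (R : ℝ) < ∫ r in (0:ℝ)..t, (P.solMap N T T r q.1 (pairPath q.2)).2 m ^ 2} := measure_biUnion_finset_le _ _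
      _ ≤ ∑ m ∈ S, ENNReal.ofReal (2027025 * T ^ 8 * t ^ 8 / (R : ℝ) ^ 8) :=
          Finset.sum_le_sum fun m _ =>
            pinnedChain_probSite_timeIntegral_momentum_sq_gt_eight hω hl.le hβ.le hγ.le N hN hT ht hR0 m
      _ = (S.card : ℝ≥0∞) * ENNReal.ofReal (2027025 * T ^ 8 * t ^ 8 / (R : ℝ) ^ 8) := by
          rw [Finset.sum_const, nsmul_eq_mul]
      _ ≤ (2 * R + 3 : ℝ≥0∞) * ENNReal.ofReal (2027025 * T ^ 8 * t ^ 8 / (R : ℝ) ^ 8) := by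
          gcongr; exact_mod_cast hcard
  exact (measure_union_le _ _).trans (add_le_add h1 h2)

end BadEvent

end Summit.AtomisticToContinuum.FouriersLaw.Theorems.NonBallistic.BulkWindowMatching

namespace Summit.AtomisticToContinuum.FouriersLaw.Theorems.NonBallistic

open MeasureTheory ProbabilityTheory Set Filter Topology Function
open scoped NNReal ENNReal
open Literature.MathematicalPhysics.KineticTheory Literature.MathematicalPhysics.KineticTheory.HeatConduction
open Literature.Probability.Process OscillatorChain
open Summit.AtomisticToContinuum.FouriersLaw.Theorems.NonBallistic.BulkWindowMatching

/-- **Registered sub-goal `stub_bulkBoxBadEvent`** (stub `stub_bulkWindowDynamicalMatching`, F1a, line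
`drude-controls-conductance`, R2b): the bad event of the anchored box is improbable uniformly in `N` and in the anchor
(`bulk_bad_event_le`, closed form; anchored twin of `stub_centredBoxBadEvent`). [folklore] -/
theorem stub_bulkBoxBadEvent :
    ∀ ω₂ lam β γ : ℝ, 0 < ω₂ → 0 < lam → 0 < β → 0 < γ → ∀ T : ℝ, 0 < T →
      ∀ (ι : (N : ℕ) → ℕ → PhaseSpace N → ChainConfig),
        (∀ (N a : ℕ) (z : PhaseSpace N) (i : ℤ),
          ι N a z i = if h : 0 ≤ i + (a : ℤ) ∧ i + (a : ℤ) < N then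
            (z.1 ⟨(i + (a : ℤ)).toNat, by omega⟩, z.2 ⟨(i + (a : ℤ)).toNat, by omega⟩)
            else (0, 0)) →
      ∀ (C : ENNReal), (∀ (N a R : ℕ), R + 1 ≤ a → a + R + 3 ≤ N →
        ∫⁻ z, ENNReal.ofReal ((pinnedChain ω₂ lam β γ).bmLocalEnergy 0 (R + 1) (ι N a z))
            ∂((pinnedChain ω₂ lam β γ).gibbsMeasure N T) ≤ (2 * R + 3 : ENNReal) * C) →
      ∀ (N a R : ℕ), R + 1 ≤ a → a + R + 3 ≤ N → 1 ≤ R → ∀ (t : ℝ), 0 ≤ t →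
        (((pinnedChain ω₂ lam β γ).gibbsMeasure N T).prod wienerPair)
            ({q : PhaseSpace N × WienerPair |
                lam * (R : ℝ) ^ 2 / 4 < (pinnedChain ω₂ lam β γ).bmLocalEnergy 0 (R + 1) (ι N a q.1)} ∪
              ⋃ m ∈ (Finset.univ.filter fun m : Fin N =>
                  -((R : ℤ) + 1) ≤ (m : ℤ) - (a : ℤ) ∧ (m : ℤ) - (a : ℤ) ≤ (R : ℤ) + 1),
                {q : PhaseSpace N × WienerPair | (R : ℝ) < ∫ r in (0:ℝ)..t,
                  ((pinnedChain ω₂ lam β γ).solMap N T T r q.1 (pairPath q.2)).2 m ^ 2}) ≤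
          (2 * R + 3 : ENNReal) * C / ENNReal.ofReal (lam * (R : ℝ) ^ 2 / 4) +
            (2 * R + 3 : ENNReal) * ENNReal.ofReal (2027025 * T ^ 8 * t ^ 8 / (R : ℝ) ^ 8) :=
  fun _ _ _ _ hω hl hβ hγ _ hT ι hι _ hC _ _ _ hRa haN hR1 _ ht => bulk_bad_event_le hω hl hβ hγ hT ι hι hC hRa haN hR1 ht

end Summit.AtomisticToContinuum.FouriersLaw.Theorems.NonBallistic

end
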